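import Mathlib
import Summits.CriticalPhenomena.CardyFormulaZ2.Theses.CardyTotalPositivity

/-!
# Birth skeleton (BC3) for the piece `FirstHitDecomposition` (stmt-CriticalPhenomena-18625)

of the glued split `AsymptoticKernelTN ⇐ HalfPlaneKernelTN ∧ FirstHitDecomposition`
(strategist cstrat-stmt-CriticalPhenomena-11297). Two registered stubs and the kernel-checked
composition `FirstHitDecomposition_of`; sorries ONLY inside `stub_*`.

* `stub_windowPartition` — the combinatorial heart: for `A ≤ B` the crossing event to `{1..A}` is
  contained in the one to `{1..B}`, and their difference is the DISJOINT union over `x ∈ (A, B]`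
  of the first-hit events `{arc ↔ (x,0)} \ {arc ↔ [1, x-1]}` (existence and uniqueness of the
  first boundary vertex hit by the cluster of the arc).
* `stub_eventsMeasurable` — the crossing / first-hit events are measurable (countably many
  vertices: `Literature.Probability.Percolation.measurableSet_openCrossing_of_countable`).
* `FirstHitDecomposition_of` — measure algebra: `measureReal_sdiff` + `measureReal_biUnion_finset`.
-/

namespace Summit.CriticalPhenomena.CardyFormulaZ2.Cruxes.AsymptoticKernelTN.FirstHitDecompositionBirth

open MeasureTheory Set Filter
open Literature.Probability.Percolation Literature.Probability.LatticeModels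
open Summit.CriticalPhenomena.CardyFormulaZ2.Theses.CardyTotalPositivity

/-- the critical bond measure on `ℤ²` -/
noncomputable abbrev μ : Measure (BondConfig (Site 2)) := bondPercolation (zdGraph 2) half

/-- the lattice upper half-plane -/
def H : Set (Site 2) := {v : Site 2 | 0 ≤ v 1}

/-- the wired arc `A_s = {(i,0) : i ≤ -s}` -/
def arc (s : ℕ) : Set (Site 2) := {v | v 1 = 0 ∧ v 0 ≤ -(s : ℤ)}

/-- the target segment `{(j,0) : 1 ≤ j ≤ B}` -/
def seg (B : ℕ) : Set (Site 2) := {v | v 1 = 0 ∧ 1 ≤ v 0 ∧ v 0 ≤ (B : ℤ)}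

/-- the window event `{A_s ↔ {1..B} in ℤ×ℕ}` -/
def E (s B : ℕ) : Set (BondConfig (Site 2)) := openCrossing H (arc s) (seg B)

/-- the first-hit event `{X^{(s)} = x}` -/
def hit (s x : ℕ) : Set (BondConfig (Site 2)) :=
  openCrossing H (arc s) {![(x : ℤ), 0]} \ openCrossing H (arc s) {v | v 1 = 0 ∧ 1 ≤ v 0 ∧ v 0 < x}

/-- the piece, unfolded over the clean names (definitional) -/
theorem firstHitDecomposition_iff :
    FirstHitDecomposition ↔ ∀ s A B : ℕ, A ≤ B →
      μ.real (E s B) - μ.real (E s A) = ∑ x ∈ Finset.Ioc A B, μ.real (hit s x) :=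
  Iff.rfl

/-- stub 1 (the combinatorial heart): first-hit partition of the window event — inclusion,
the set identity, and pairwise disjointness of the first-hit events. -/
theorem stub_windowPartition : ∀ s A B : ℕ, A ≤ B →
    E s A ⊆ E s B ∧ (E s B \ E s A = ⋃ x ∈ Finset.Ioc A B, hit s x) ∧
      (↑(Finset.Ioc A B) : Set ℕ).PairwiseDisjoint (hit s) := by
  sorry

/-- stub 2: measurability of the window events and of the first-hit events. -/
theorem stub_eventsMeasurable : ∀ s : ℕ,
    (∀ B : ℕ, MeasurableSet (E s B)) ∧ (∀ x : ℕ, MeasurableSet (hit s x)) := by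
  sorry

/-- composition: the two stubs give the piece (measure of a difference of nested events, then
finite additivity over the disjoint first-hit events). -/
theorem FirstHitDecomposition_of
    (h1 : ∀ s A B : ℕ, A ≤ B →
      E s A ⊆ E s B ∧ (E s B \ E s A = ⋃ x ∈ Finset.Ioc A B, hit s x) ∧
        (↑(Finset.Ioc A B) : Set ℕ).PairwiseDisjoint (hit s))
    (h2 : ∀ s : ℕ, (∀ B : ℕ, MeasurableSet (E s B)) ∧ (∀ x : ℕ, MeasurableSet (hit s x))) :
    FirstHitDecomposition := by
  rw [firstHitDecomposition_iff]
  intro s A B hAB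
  obtain ⟨hsub, hdiff, hdisj⟩ := h1 s A B hAB
  obtain ⟨hE, hhit⟩ := h2 s
  rw [← measureReal_sdiff hsub (hE A), hdiff]
  exact measureReal_biUnion_finset hdisj (fun x _ ↦ hhit x)

end Summit.CriticalPhenomena.CardyFormulaZ2.Cruxes.AsymptoticKernelTN.FirstHitDecompositionBirth
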